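import Summits.Ventures.HSemireg.Pad4TowerB1OddSpanControl

/-!
# Venture HSemireg — PAD-4 on 𝔅(μ₄): SPAN CONTROL, part 2∕2 — BOOST BLINDNESS of the static H₁ game PROVED; threshold extremality; the inter-height law

HONEST FRAMING as in part 1 (`Pad4TowerB1OddSpanControl`): census-neutral theorems about the typed static predicates of record, line
stmt-HodgeConjecture-18881 (STUB R negative side ∕ instrument), lens ideator `plan-lens-HodgeAV-control` on director-hodge R16.6 (1) ∕ critic idea-crit-6 L1;
NOTHING HERE SAYS THAT HC ∕ HC_CM ∕ HC_AV ∕ H2 HOLDS OR FAILS; `(T_8) = SeedB1OddDiamond8G1H1` is NOT decided here. No `sorry` ∕ `axiom` ∕ `instance` ∕ notation ∕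
Literature fact. Width toward H2 = 0. Section numbers are those of the Sketch `Cruxes/BlochSeedDiscOne/B1OddSpanControl.lean` v5 651a2b039531c043.

WHAT.
* §7 **K1 PROVED** — the boost analogue of LEMMA T (torus blindness, `Pad4TowerTorusBlindBase` ∕ `Pad4TowerTorusBlind`, gs-eng-2 g53): RULE D and the X family
  read only `β`-components and DIFFERENCES of `α`, so they are blind to EVERY boost of EVERY configuration (`ruleDMu4Closed_boostImage`, `xresXClosed_boostImage`,
  `xPlusClosed_boostImage` via `dual ∘ boost s = boost (−s) ∘ dual`); the A2I⁻ family reads the sign of `α(Z_σ)` (`EncDir`), which the cone hypotheses fix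
  (`xresA2IClosed_boostImage`). Hence `staticH1BoostInvariant_holds` and UNCONDITIONALLY **SPAN CONTROL** `seedB1OddAnchored_iff h` (a counterexample may be
  taken FLOOR-ANCHORED: span = top height), `diagUnitRealisable_step`, `diagUnits_next_height_holds` (given the ◇₈ model of `[6I+ℓ_u]⁴`, both `[6I+ℓ_u]⁴` and
  `[8I+ℓ_u]⁴` are realisable at `◇₁₀`: (CUL-h) ∕ verbatim (W′) «FC ⇒ ceiling unit» cannot extend beyond `h = 8`; the uniform sentence is (DUL-h)).
* §8 THRESHOLD EXTREMALITY `threshold_support_spans` (even `h`): under `(T_{h−2})` every counterexample to `(T_h)` is floor- AND ceiling-anchored;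
  `threshold_support_spans_eight` takes `(T_6)` as a HYPOTHESIS (machine ×1, j309860 — not a theorem).
* §9 the INTER-HEIGHT LAW, semantic form: `cellRealisable_mono` (`Real_h ⊆ Real_{h'}`), `cellRealisable_boost` (`Real_h + 2I ⊆ Real_{h+2}`),
  `cellRealisable_translate` — the typed counterpart of the table-level peel law `Surv_{h−2} ⊆ Surv_h`, `Surv_{h−2} + 2I ⊆ Surv_h` (the peel survivor sets
  over-approximate `Real`; the table law additionally needs the ENCODER to be boost-equivariant = falsifier F1).
With LEMMA T: the static H₁ game is blind to `(ℤ∕4)⁴` phase rotations AND to light-cone translations; only `G1Closed`'s `S₄` half and the two boundary lines of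
`◇_h` can see an odd-FC counterexample. SOURCES: part 1; `Pad4TowerRuleDMu4` ∕ `Pad4TowerRuleDMu4Dual` (`dualPt`, `dualCell`, `MConfig.dual`) ∕ `Pad4TowerXresFamilies`
∕ `Pad4TowerA2IMu4`; census rows W16–W19, W22 of `hodge-bloch-bc5-plan` birth-v4.md v4.20; card `Cruxes/BlochSeedDiscOne/Ideas/b1odd-span-control.md` v1.2;
ideators/idea-crit-6 INBOX 15:56Z (K1 PROVED) ∕ 16:07Z (R16.6: verified on the critic's copy, axioms propext ∕ Classical.choice ∕ Quot.sound). -/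

namespace Summit.Ventures.HSemireg.Pad4Tower

open Finset

/-! ## §7 K1 PROVED: boost blindness of the static bundle `H₁` (the boost analogue of LEMMA T `Pad4TowerTorusBlind`)
RULE D and the `X` family read only `β`-components and DIFFERENCES of `α`, so they are invariant under EVERY boost of EVERY
configuration (no cone hypothesis; `X+` through `dual ∘ boost s = boost (−s) ∘ dual`); the `A2I−` family reads the sign of `α(Z_σ)`
(`EncDir`, the guard), which the cone hypotheses fix. -/

section BoostBlind

/-- the boost of a cell, letterwise. -/
theorem boost_apply (s : ℤ) (Z : MCell) (f : Fin 4) : Z.boost s f = boostPt s (Z f) := rfl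
/-- the boost shifts `α` by `s` … -/
theorem boostPt_fst (s : ℤ) (x : BPoint) : (boostPt s x).1 = x.1 + s := rfl
/-- … and fixes `β`. -/
theorem boostPt_snd (s : ℤ) (x : BPoint) : (boostPt s x).2 = x.2 := rfl
/-- the lower level of the boosted configuration. -/
theorem boostImage_lower (s : ℤ) (C : MConfig) : (C.boostImage s).lower = C.lower.image (MCell.boost s) := rfl
/-- the upper level of the boosted configuration. -/
theorem boostImage_upper (s : ℤ) (C : MConfig) : (C.boostImage s).upper = C.upper.image (MCell.boost s) := rfl
/-- the boost commutes with null rays … -/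
theorem boostPt_ray (s : ℤ) (x : BPoint) (k : Fin 4) (e : ℤ) : boostPt s (ray x k e) = ray (boostPt s x) k e := by
  refine Prod.ext ?_ rfl
  show x.1 + e + s = x.1 + s + e
  ring
/-- … so ray relations are boost-invariant. -/
theorem boostPt_eq_ray_iff (s : ℤ) (x y : BPoint) (k : Fin 4) (e : ℤ) :
    boostPt s y = ray (boostPt s x) k e ↔ y = ray x k e := by
  rw [← boostPt_ray]; exact (boostPt_injective s).eq_iff
/-- differences are boost-invariant (the whole point). -/
theorem bsub_boostPt (s : ℤ) (x y : BPoint) : bsub (boostPt s x) (boostPt s y) = bsub x y := by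
  refine Prod.ext ?_ rfl
  show x.1 + s - (y.1 + s) = x.1 - y.1
  ring
/-- `NullBelow` is boost-invariant (a difference of `α`'s). -/
theorem nullBelow_boostPt (s : ℤ) (y x : BPoint) : NullBelow (boostPt s y) (boostPt s x) ↔ NullBelow y x := by
  show (y.1 + s < x.1 + s ∧ (x.2.1 - y.2.1) ^ 2 + (x.2.2 - y.2.2) ^ 2 = (x.1 + s - (y.1 + s)) ^ 2) ↔
    (y.1 < x.1 ∧ (x.2.1 - y.2.1) ^ 2 + (x.2.2 - y.2.2) ^ 2 = (x.1 - y.1) ^ 2)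
  rw [add_sub_add_right_eq_sub, add_lt_add_iff_right]
/-- apexhood reads `β` only. -/
theorem isApex_boostPt (s : ℤ) (x : BPoint) : isApex (boostPt s x) ↔ isApex x := Iff.rfl
/-- `cabs` reads `β` only. -/
theorem cabs_boostPt (s : ℤ) (x : BPoint) : cabs (boostPt s x) = cabs x := rfl
/-- `Adapted` reads `β` only. -/
theorem adapted_boostPt (s : ℤ) (x : BPoint) (k : Fin 4) : Adapted (boostPt s x) k ↔ Adapted x k := Iff.rfl
/-- `DirOK` reads `β` only. -/
theorem dirOK_boostPt (s : ℤ) (x : BPoint) (k a : Fin 4) : DirOK (boostPt s x) k a ↔ DirOK x k a := Iff.rfl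
/-- frame coordinates shift by `s`. -/
theorem coord_boostPt (s : ℤ) (x : BPoint) (k : Fin 4) : coord (boostPt s x) k = coord x k + s := by
  show x.1 + s + ![x.2.1, -x.2.2, -x.2.1, x.2.2] k = x.1 + ![x.2.1, -x.2.2, -x.2.1, x.2.2] k + s
  ring
/-- `OnULineBelowEq` is boost-invariant (differences of `α` and ray relations). -/
theorem onULineBelowEq_boostPt (s : ℤ) (x y : BPoint) (u : Fin 4) :
    OnULineBelowEq (boostPt s x) (boostPt s y) u ↔ OnULineBelowEq x y u := by
  simp only [OnULineBelowEq, add_le_add_iff_right, add_sub_add_right_eq_sub, boostPt_eq_ray_iff]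

/-- the encoder's own-ray direction is boost-invariant ON THE UPPER CONE (both signs non-negative). -/
theorem encDir_boostPt {s : ℤ} {x : BPoint} (h0 : 0 ≤ x.1) (h1 : 0 ≤ x.1 + s) (u : Fin 4) :
    EncDir (boostPt s x) u ↔ EncDir x u := by
  have key : ∀ c : ℤ, boostPt s x = ray (x.1 + s - cabs x, 0, 0) u c ↔ x = ray (x.1 - cabs x, 0, 0) u c := fun c => by
    have e : ((x.1 + s - cabs x, 0, 0) : BPoint) = boostPt s (x.1 - cabs x, 0, 0) :=
      Prod.ext (by show x.1 + s - cabs x = x.1 - cabs x + s; ring) rfl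
    rw [e, boostPt_eq_ray_iff]
  show ((0 ≤ x.1 + s ∧ boostPt s x = ray (x.1 + s - cabs x, 0, 0) u (cabs x)) ∨
      (x.1 + s < 0 ∧ boostPt s x = ray (x.1 + s + cabs x, 0, 0) u (-(cabs x)))) ↔
    ((0 ≤ x.1 ∧ x = ray (x.1 - cabs x, 0, 0) u (cabs x)) ∨ (x.1 < 0 ∧ x = ray (x.1 + cabs x, 0, 0) u (-(cabs x))))
  rw [key]
  constructor
  · rintro (⟨-, h⟩ | ⟨h, -⟩)
    · exact Or.inl ⟨h0, h⟩
    · exact absurd h (by omega)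
  · rintro (⟨-, h⟩ | ⟨h, -⟩)
    · exact Or.inl ⟨h1, h⟩
    · exact absurd h (by omega)

/-! ### transport of bounded quantifiers along the boosted levels -/

/-- bounded `∀` over a boosted level, transported to the original level. -/
theorem forall_image_boost {S : Finset MCell} {s : ℤ} {p : MCell → Prop} :
    (∀ W ∈ S.image (MCell.boost s), p W) ↔ ∀ Z ∈ S, p (Z.boost s) := by
  constructor
  · intro H Z hZ; exact H _ (Finset.mem_image_of_mem _ hZ)
  · intro H W hW
    obtain ⟨Z, hZ, rfl⟩ := Finset.mem_image.mp hW
    exact H Z hZ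

/-- bounded `∀` over the boosted lower level. -/
theorem forall_boostImage_lower {s : ℤ} {C : MConfig} {p : MCell → Prop} :
    (∀ Z ∈ (C.boostImage s).lower, p Z) ↔ ∀ Z ∈ C.lower, p (Z.boost s) := forall_image_boost
/-- bounded `∀` over the boosted upper level. -/
theorem forall_boostImage_upper {s : ℤ} {C : MConfig} {p : MCell → Prop} :
    (∀ P ∈ (C.boostImage s).upper, p P) ↔ ∀ P ∈ C.upper, p (P.boost s) := forall_image_boost
/-- bounded `∃` over the boosted lower level. -/
theorem exists_boostImage_lower {s : ℤ} {C : MConfig} {p : MCell → Prop} :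
    (∃ Z ∈ (C.boostImage s).lower, p Z) ↔ ∃ Z ∈ C.lower, p (Z.boost s) := exists_image_boost
/-- bounded `∃` over the boosted upper level. -/
theorem exists_boostImage_upper {s : ℤ} {C : MConfig} {p : MCell → Prop} :
    (∃ P ∈ (C.boostImage s).upper, p P) ↔ ∃ P ∈ C.upper, p (P.boost s) := exists_image_boost

/-! ### cell relations -/

/-- `MAgree` is boost-invariant. -/
theorem magree_boost (s : ℤ) (P Z : MCell) (σ : Fin 4) : MAgree (P.boost s) (Z.boost s) σ ↔ MAgree P Z σ := by
  simp only [MAgree, boost_apply, (boostPt_injective s).eq_iff]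
/-- `MAgree2` is boost-invariant. -/
theorem magree2_boost (s : ℤ) (P Z : MCell) (g j : Fin 4) : MAgree2 (P.boost s) (Z.boost s) g j ↔ MAgree2 P Z g j := by
  simp only [MAgree2, boost_apply, (boostPt_injective s).eq_iff]
/-- `UPartner` is boost-invariant. -/
theorem uPartner_boost (s : ℤ) (Z q : MCell) (σ k : Fin 4) : UPartner (Z.boost s) (q.boost s) σ k ↔ UPartner Z q σ k := by
  simp only [UPartner, magree_boost, boost_apply, boostPt_fst, add_lt_add_iff_right, add_sub_add_right_eq_sub,
    boostPt_eq_ray_iff]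
/-- `Sibling` is boost-invariant. -/
theorem sibling_boost (s : ℤ) (q n : MCell) (σ w : Fin 4) : Sibling (q.boost s) (n.boost s) σ w ↔ Sibling q n σ w := by
  simp only [Sibling, magree_boost, boost_apply, boostPt_fst, add_lt_add_iff_right, add_sub_add_right_eq_sub,
    boostPt_eq_ray_iff]

variable (s : ℤ) (C : MConfig)

/-! ### RULE D is boost-blind (every configuration, every boost) -/

/-- `MServedBelow` is boost-invariant. -/
theorem mServedBelow_boost (Z : MCell) (f k : Fin 4) :
    MServedBelow (C.boostImage s) (Z.boost s) f k ↔ MServedBelow C Z f k := by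
  simp only [MServedBelow, exists_boostImage_upper, uPartner_boost]
/-- `MServedAbove` is boost-invariant. -/
theorem mServedAbove_boost (P : MCell) (f k : Fin 4) :
    MServedAbove (C.boostImage s) (P.boost s) f k ↔ MServedAbove C P f k := by
  simp only [MServedAbove, exists_boostImage_lower, uPartner_boost]
/-- `SettledBelow` is boost-invariant. -/
theorem settledBelow_boost (Z : MCell) (f k : Fin 4) :
    SettledBelow (C.boostImage s) (Z.boost s) f k ↔ SettledBelow C Z f k := by
  simp only [SettledBelow, mServedBelow_boost]
/-- `SettledAbove` is boost-invariant. -/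
theorem settledAbove_boost (P : MCell) (f k : Fin 4) :
    SettledAbove (C.boostImage s) (P.boost s) f k ↔ SettledAbove C P f k := by
  simp only [SettledAbove, mServedAbove_boost]
/-- `MCoverBelow` is boost-invariant. -/
theorem mCoverBelow_boost (Z : MCell) (g a j b : Fin 4) :
    MCoverBelow (C.boostImage s) (Z.boost s) g a j b ↔ MCoverBelow C Z g a j b := by
  simp only [MCoverBelow, exists_boostImage_upper, magree2_boost, boost_apply, boostPt_fst, add_lt_add_iff_right,
    add_sub_add_right_eq_sub, boostPt_eq_ray_iff]
/-- `MCoverAbove` is boost-invariant. -/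
theorem mCoverAbove_boost (P : MCell) (g a j b : Fin 4) :
    MCoverAbove (C.boostImage s) (P.boost s) g a j b ↔ MCoverAbove C P g a j b := by
  simp only [MCoverAbove, exists_boostImage_lower, magree2_boost, boost_apply, boostPt_fst, add_lt_add_iff_right,
    add_sub_add_right_eq_sub, boostPt_eq_ray_iff]
/-- `CoveredBelow` is boost-invariant. -/
theorem coveredBelow_boost (Z : MCell) (g k j k' : Fin 4) :
    CoveredBelow (C.boostImage s) (Z.boost s) g k j k' ↔ CoveredBelow C Z g k j k' := by
  simp only [CoveredBelow, boost_apply, dirOK_boostPt, mCoverBelow_boost]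
/-- `CoveredAbove` is boost-invariant. -/
theorem coveredAbove_boost (P : MCell) (g k j k' : Fin 4) :
    CoveredAbove (C.boostImage s) (P.boost s) g k j k' ↔ CoveredAbove C P g k j k' := by
  simp only [CoveredAbove, boost_apply, dirOK_boostPt, mCoverAbove_boost]
/-- RULE D at an `N` is boost-invariant (coordinate VALUES shift together: `coord_boostPt`). -/
theorem ruleDMu4N_boost (Z : MCell) : RuleDMu4N (C.boostImage s) (Z.boost s) ↔ RuleDMu4N C Z := by
  simp only [RuleDMu4N, boost_apply, adapted_boostPt, coord_boostPt, ne_eq, add_left_inj, settledBelow_boost,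
    coveredBelow_boost]
/-- RULE D at a `P` is boost-invariant. -/
theorem ruleDMu4P_boost (P : MCell) : RuleDMu4P (C.boostImage s) (P.boost s) ↔ RuleDMu4P C P := by
  simp only [RuleDMu4P, boost_apply, adapted_boostPt, coord_boostPt, ne_eq, add_left_inj, settledAbove_boost,
    coveredAbove_boost]
/-- **RULE D is boost-blind.** -/
theorem ruleDMu4Closed_boostImage : RuleDMu4Closed (C.boostImage s) ↔ RuleDMu4Closed C := by
  simp only [RuleDMu4Closed, forall_boostImage_lower, forall_boostImage_upper, ruleDMu4N_boost, ruleDMu4P_boost]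

/-! ### the X family is boost-blind (every configuration, every boost) -/

/-- `NoCompanion` is boost-invariant. -/
theorem noCompanion_boost (q n : MCell) (σ w : Fin 4) :
    NoCompanion (C.boostImage s) (q.boost s) (n.boost s) σ w ↔ NoCompanion C q n σ w := by
  simp only [NoCompanion, forall_boostImage_upper, magree_boost, boost_apply, boostPt_fst, add_lt_add_iff_right,
    add_sub_add_right_eq_sub, ne_eq, boostPt_eq_ray_iff]
/-- `HeOkP` is boost-invariant. -/
theorem heOkP_boost (Z q n : MCell) (σ : Fin 4) :
    HeOkP (C.boostImage s) (Z.boost s) (q.boost s) (n.boost s) σ ↔ HeOkP C Z q n σ := by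
  simp only [HeOkP, forall_boostImage_upper, magree_boost, boost_apply, ne_eq, (boostPt_injective s).eq_iff, bsub_boostPt]
/-- `HbOkP` is boost-invariant. -/
theorem hbOkP_boost (Z n : MCell) (σ f : Fin 4) :
    HbOkP (C.boostImage s) (Z.boost s) (n.boost s) σ f ↔ HbOkP C Z n σ f := by
  simp only [HbOkP, forall_boostImage_upper, magree2_boost, boost_apply, nullBelow_boostPt, bsub_boostPt]
/-- `WfEmpty` is boost-invariant. -/
theorem wfEmpty_boost (Z : MCell) (f : Fin 4) : WfEmpty (C.boostImage s) (Z.boost s) f ↔ WfEmpty C Z f := by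
  simp only [WfEmpty, forall_boostImage_upper, magree_boost, magree2_boost, boost_apply, nullBelow_boostPt]
/-- an X-family instance fires after the boost iff it fires before. -/
theorem xresXFires_boost (Z q n : MCell) (σ u w f : Fin 4) :
    XresXFires (C.boostImage s) (Z.boost s) (q.boost s) (n.boost s) σ u w f ↔ XresXFires C Z q n σ u w f := by
  simp only [XresXFires, uPartner_boost, sibling_boost, noCompanion_boost, heOkP_boost, hbOkP_boost, wfEmpty_boost,
    forall_boostImage_upper, ne_eq, boost_apply, isApex_boostPt, boostPt_fst, add_le_add_iff_right]
/-- **the X family is boost-blind** (X⁻ reading). -/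
theorem xresXClosed_boostImage : XresXClosed (C.boostImage s) ↔ XresXClosed C := by
  simp only [XresXClosed, forall_boostImage_lower, forall_boostImage_upper, xresXFires_boost]
/-- the dual turns a boost by `s` into a boost by `−s` … -/
theorem dualPt_boostPt (x : BPoint) : dualPt 0 (boostPt s x) = boostPt (-s) (dualPt 0 x) := by
  refine Prod.ext ?_ rfl
  show 0 - (x.1 + s) = 0 - x.1 + -s
  ring
/-- … cellwise … -/
theorem dualCell_boost (Z : MCell) : dualCell 0 (Z.boost s) = (dualCell 0 Z).boost (-s) :=
  funext fun f => dualPt_boostPt s (Z f)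
/-- … and on configurations: `dual ∘ boost s = boost (−s) ∘ dual`. -/
theorem dual_boostImage : (C.boostImage s).dual 0 = (C.dual 0).boostImage (-s) := by
  simp only [MConfig.dual, MConfig.boostImage, Finset.image_image, MConfig.mk.injEq]
  constructor <;> (congr 1; funext X; exact dualCell_boost s X)
/-- **… so X⁺ (the dual reading) is boost-blind too.** -/
theorem xPlusClosed_boostImage : XPlusClosed (C.boostImage s) ↔ XPlusClosed C := by
  rw [XPlusClosed, dual_boostImage, xresXClosed_boostImage]

/-! ### the A2I family is boost-blind on the cone -/

/-- an A2I instance fires after the boost iff before, provided the pivot letter `Z σ` has `α ≥ 0` before and after (the `EncDir` guard). -/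
theorem xresA2IFires_boost {s : ℤ} {C : MConfig} {Z : MCell} {σ : Fin 4} (h0 : 0 ≤ (Z σ).1) (h1 : 0 ≤ (Z σ).1 + s)
    (q N' : MCell) (u f' v : Fin 4) :
    XresA2IFires (C.boostImage s) (Z.boost s) (q.boost s) (N'.boost s) σ u f' v ↔ XresA2IFires C Z q N' σ u f' v := by
  simp only [XresA2IFires, uPartner_boost, forall_boostImage_upper, magree_boost, magree2_boost, boost_apply, isApex_boostPt,
    boostPt_fst, cabs_boostPt, encDir_boostPt h0 h1, nullBelow_boostPt, bsub_boostPt, onULineBelowEq_boostPt,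
    boostPt_eq_ray_iff, (boostPt_injective s).eq_iff, ne_eq, add_lt_add_iff_right, add_le_add_iff_right,
    add_sub_add_right_eq_sub, h0, h1, true_implies]

/-- a cone letter has `α ≥ 0`. -/
theorem nonneg_of_inCone {x : BPoint} (hx : InCone x) : 0 ≤ x.1 := by
  have h1 := hx.2.1
  have h2 : 0 ≤ absCharge x := abs_nonneg _
  omega

/-- **the A2I⁻ family is boost-blind between cone configurations.** -/
theorem xresA2IClosed_boostImage {s : ℤ} {C : MConfig} (hC : C.InCone) (hC' : (C.boostImage s).InCone) :
    XresA2IClosed (C.boostImage s) ↔ XresA2IClosed C := by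
  simp only [XresA2IClosed, forall_boostImage_lower, forall_boostImage_upper]
  refine forall_congr' fun Z => forall_congr' fun hZ => forall_congr' fun q => forall_congr' fun _ =>
    forall_congr' fun N' => forall_congr' fun _ => forall_congr' fun σ => forall_congr' fun u =>
    forall_congr' fun f' => forall_congr' fun v => ?_
  have h0 : 0 ≤ (Z σ).1 := nonneg_of_inCone (hC.1 Z hZ σ)
  have h1 : 0 ≤ (Z σ).1 + s := nonneg_of_inCone (hC'.1 (Z.boost s) (Finset.mem_image_of_mem _ hZ) σ)
  rw [xresA2IFires_boost h0 h1]

/-! ### K1 assembled -/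

/-- **K1 (`StaticH1BoostCore`) PROVED.** -/
theorem staticH1BoostCore_holds : StaticH1BoostCore := fun s C hC hC' =>
  (and_congr (ruleDMu4Closed_boostImage s C)
    (and_congr (xPlusClosed_boostImage s C) (xresA2IClosed_boostImage hC hC'))).symm
/-- **THE FIRST LEMMA OF THE LINE IS A THEOREM: boost blindness of H₁, G₁ and odd-FC presence.** -/
theorem staticH1BoostInvariant_holds : StaticH1BoostInvariant := staticH1BoostInvariant_of_core staticH1BoostCore_holds
/-- **SPAN CONTROL, unconditionally**: at every height, (B1-odd) for all supports ⟺ (B1-odd) for floor-anchored supports. -/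
theorem seedB1OddAnchored_iff (h : ℤ) : SeedB1OddAnchored h ↔ SeedB1OddDiamondG1H1 h :=
  spanControl staticH1BoostInvariant_holds h

/-- **the census correction, unconditionally**: a diagonal unit realisable at `◇_h` is realisable one node level up at `◇_{h+2}`;
with j298438's `[6I+ℓ_u]⁴` at `◇₈` (a model, not a theorem here): `[6I+ℓ_u]⁴` (interior) and `[8I+ℓ_u]⁴` at `◇₁₀`. -/
theorem diagUnitRealisable_step {h t : ℤ} (ht : 0 ≤ t) (H : DiagUnitRealisable h t) : DiagUnitRealisable (h + 2) (t + 2) :=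
  diagUnitRealisableBoost staticH1BoostInvariant_holds h t ht H

/-- **unconditionally**: `[6I+ℓ_u]⁴` realisable at `◇_h` gives `[6I+ℓ_u]⁴` AND `[8I+ℓ_u]⁴` realisable at `◇_{h+2}` (= PREREG dd6eeaf705c32404 soundness row 4 at `h = 8 ↦ 10`, given the ◇₈ model). -/
theorem diagUnits_next_height_holds {h : ℤ} (h6 : DiagUnitRealisable h 6) :
    DiagUnitRealisable (h + 2) 6 ∧ DiagUnitRealisable (h + 2) 8 :=
  diagUnits_next_height staticH1BoostCore_holds h6

end BoostBlind

/-! ## §8 THRESHOLD EXTREMALITY (unconditional): a first counterexample spans the whole diamond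
At the threshold height (`(T_{h−2})` true, `(T_h)` false) every counterexample touches the CEILING line `α + c = h` (else it
lies in `◇_{h−2}`) AND the FLOOR line `α = c` (else its boost by `−2` lies in `◇_{h−2}` and §7 transports staticity, closure and
the odd FC cell) — the typed form of «all 14 static-clean ◇₈ supports touch both the floor junk and the ceiling unit». -/

/-- a support is CEILING-ANCHORED in `◇_h`: some letter of some present cell lies on the ceiling line `α + c = h`. -/
abbrev MConfig.CeilingAnchored (C : MConfig) (h : ℤ) : Prop :=
  (∃ Z ∈ C.lower, ∃ f, OnCeiling h (Z f)) ∨ ∃ P ∈ C.upper, ∃ f, OnCeiling h (P f)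

/-- **THRESHOLD EXTREMALITY** (even heights): under `(T_{h−2})`, a counterexample to `(T_h)` is floor- AND ceiling-anchored. -/
theorem threshold_support_spans {h : ℤ} (hh : h % 2 = 0) (Hprev : SeedB1OddDiamondG1H1 (h - 2)) {C : MConfig}
    (hU : C.InDiamond h) (hG : C.G1Closed) (hS : C.StaticH1) (hodd : C.HasOddFC) :
    C.FloorAnchored ∧ C.CeilingAnchored h := by
  have hdia : ∀ Z, (Z ∈ C.lower ∨ Z ∈ C.upper) → ∀ f, InDiamond h (Z f) := fun Z hZ f =>
    hZ.elim (fun hZ => hU.1 Z hZ f) (fun hZ => hU.2 Z hZ f)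
  constructor
  · by_contra hA
    have key : ∀ Z, (Z ∈ C.lower ∨ Z ∈ C.upper) → ∀ f, InDiamond (h - 2) (boostPt (-2) (Z f)) := by
      intro Z hZ f
      have hx := hdia Z hZ f
      have hnf : ¬ ((Z f).1 = absCharge (Z f)) := fun hfl =>
        hA (hZ.elim (fun hZ => Or.inl ⟨Z, hZ, f, hfl⟩) (fun hZ => Or.inr ⟨Z, hZ, f, hfl⟩))
      have h1 := hx.2.1
      have h2 := hx.2.2.1
      have h3 := hx.2.2.2
      exact inDiamond_boostPt hx (by omega) (by omega) (by omega)
    have hU' : (C.boostImage (-2)).InDiamond (h - 2) := by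
      constructor
      · intro W hW f
        obtain ⟨Z, hZ, rfl⟩ := Finset.mem_image.mp hW
        exact key Z (Or.inl hZ) f
      · intro W hW f
        obtain ⟨Z, hZ, rfl⟩ := Finset.mem_image.mp hW
        exact key Z (Or.inr hZ) f
    obtain ⟨hSi, hGi, hOi⟩ := staticH1BoostInvariant_holds (-2) C (inCone_of_inDiamond' hU) (inCone_of_inDiamond' hU')
    exact Hprev _ hU' (hGi.mp hG) (hSi.mp hS) (hOi.mp hodd)
  · by_contra hT
    have key : ∀ Z, (Z ∈ C.lower ∨ Z ∈ C.upper) → ∀ f, InDiamond (h - 2) (Z f) := by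
      intro Z hZ f
      have hx := hdia Z hZ f
      have hnc : ¬ ((Z f).1 + absCharge (Z f) = h) := fun hc =>
        hT (hZ.elim (fun hZ => Or.inl ⟨Z, hZ, f, hc⟩) (fun hZ => Or.inr ⟨Z, hZ, f, hc⟩))
      have h1 := hx.2.1
      have h2 := hx.2.2.1
      have h3 := hx.2.2.2
      exact ⟨hx.1, h1, h2, by omega⟩
    exact Hprev C ⟨fun Z hZ f => key Z (Or.inl hZ) f, fun P hP f => key P (Or.inr hP) f⟩ hG hS hodd

/-- in particular at the height of record: given the ◇₆ statement `(T_6)` (machine ×1, j309860 — a HYPOTHESIS here, not a theorem),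
every ◇₈ counterexample to `SeedB1OddDiamond8G1H1` is floor- and ceiling-anchored. -/
theorem threshold_support_spans_eight (H6 : SeedB1OddDiamondG1H1 6) {C : MConfig} (hU : C.InDiamond 8) (hG : C.G1Closed)
    (hS : C.StaticH1) (hodd : C.HasOddFC) : C.FloorAnchored ∧ C.CeilingAnchored 8 :=
  threshold_support_spans (h := 8) (by decide) H6 hU hG hS hodd

/-! ## §9 THE INTER-HEIGHT LAW, semantic form (unconditional): realisability of a cell is monotone in `h` and boost-equivariant
`Real_h ⊆ Real_{h+2}` and `Real_h + 2I ⊆ Real_{h+2}` for TRUE realisability (membership in some H₁-static G₁-closed ◇_h support) — the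
typed counterpart of the table-level law `Surv_{h−2} ⊆ Surv_h`, `Surv_{h−2} + 2I ⊆ Surv_h` (the peel survivor sets over-approximate
`Real`; the table law additionally needs the ENCODER to be boost-equivariant = falsifier F1). -/

/-- the cell `Z` is REALISABLE at height `h` on the lower (`lowerLevel = true`) or upper level of some H₁-static G₁-closed ◇_h support. -/
def CellRealisable (h : ℤ) (lowerLevel : Bool) (Z : MCell) : Prop :=
  ∃ C : MConfig, C.InDiamond h ∧ C.G1Closed ∧ C.StaticH1 ∧ (if lowerLevel then Z ∈ C.lower else Z ∈ C.upper)
/-- `Real_h ⊆ Real_{h'}` for `h ≤ h'` (same support). -/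
theorem cellRealisable_mono {h h' : ℤ} (hh : h ≤ h') {b : Bool} {Z : MCell} (H : CellRealisable h b Z) :
    CellRealisable h' b Z := by
  obtain ⟨C, hU, hG, hS, hZ⟩ := H
  exact ⟨C, ⟨fun W hW f => inDiamond_mono hh (hU.1 W hW f), fun P hP f => inDiamond_mono hh (hU.2 P hP f)⟩, hG, hS, hZ⟩

/-- the boosted support lies two rungs up. -/
theorem inDiamond_boostImage_two {h : ℤ} {C : MConfig} (hU : C.InDiamond h) : (C.boostImage 2).InDiamond (h + 2) := by
  constructor
  · intro W hW f
    obtain ⟨Z, hZ, rfl⟩ := Finset.mem_image.mp hW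
    have hx := hU.1 Z hZ f
    show InDiamond (h + 2) (boostPt 2 (Z f))
    exact inDiamond_boostPt hx (by decide) (by have := hx.2.1; omega) (by have := hx.2.2.2; omega)
  · intro W hW f
    obtain ⟨Z, hZ, rfl⟩ := Finset.mem_image.mp hW
    have hx := hU.2 Z hZ f
    show InDiamond (h + 2) (boostPt 2 (Z f))
    exact inDiamond_boostPt hx (by decide) (by have := hx.2.1; omega) (by have := hx.2.2.2; omega)

/-- **`Real_h + 2I ⊆ Real_{h+2}`**: the boost by `+2` of a realisable cell is realisable two rungs up (boost blindness §7). -/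
theorem cellRealisable_boost {h : ℤ} {b : Bool} {Z : MCell} (H : CellRealisable h b Z) :
    CellRealisable (h + 2) b (Z.boost 2) := by
  obtain ⟨C, hU, hG, hS, hZ⟩ := H
  have hU' := inDiamond_boostImage_two hU
  obtain ⟨hSi, hGi, -⟩ := staticH1BoostInvariant_holds 2 C (inCone_of_inDiamond' hU) (inCone_of_inDiamond' hU')
  refine ⟨C.boostImage 2, hU', hGi.mp hG, hSi.mp hS, ?_⟩
  cases b
  · simp only [Bool.false_eq_true, ↓reduceIte] at hZ ⊢
    exact Finset.mem_image_of_mem _ hZ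
  · simp only [↓reduceIte] at hZ ⊢
    exact Finset.mem_image_of_mem _ hZ

/-- hence the set of heights at which the upward translates of a realisable cell are realisable is an UP-SET in steps of 2:
cell by cell, `(T_h)`-type exclusions can only get HARDER with `h`. -/
theorem cellRealisable_translate {h : ℤ} {b : Bool} {Z : MCell} (H : CellRealisable h b Z) (n : ℕ) :
    CellRealisable (h + 2 * n) b (Z.boost (2 * n)) := by
  induction n with
  | zero => simpa [boost_zero] using H
  | succ n ih =>
    have := cellRealisable_boost ih
    rw [boost_boost] at this
    have e1 : h + 2 * (n : ℤ) + 2 = h + 2 * ((n + 1 : ℕ) : ℤ) := by push_cast; ring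
    have e2 : 2 * (n : ℤ) + 2 = 2 * ((n + 1 : ℕ) : ℤ) := by push_cast; ring
    rw [e1, e2] at this
    exact this

end Summit.Ventures.HSemireg.Pad4Tower
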